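import Summits.CriticalPhenomena.CardyFormulaZ2.Theorems.CardyFlipRussoCoveringLegStubBlocking
import Summits.CriticalPhenomena.CardyFormulaZ2.Theorems.CardyFlipRussoCoveringLegStubGsPlanar
import HarnessLib

/-!
# Wide blocking for the embedding bridge `stub_gsCardyOfUnionJack` (crux `Target`, line `Sketch` v8)

Helper file `--supports stmt-CriticalPhenomena-6431` (route `CardyFlipRusso`, sub-problem
`CriticalPhenomena/CardyFormulaZ2`, crux `Summit.CriticalPhenomena.CardyFormulaZ2.Theses.CardyFlipRusso.Target`,
registered stub `stub_gsCardyOfUnionJack` = the embedding bridge "Union-Jack crude Cardy ⟹ frame-A crude Cardy").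
The bridge is the Bollobás–Riordan collar sandwich of `CardyFlipRussoCoveringLegRobust.lean` (crux `CoveringLeg`,
p142502) run in the OPPOSITE direction; this file is the exact-duality input of its limsup half, the registered sub-goal
`gsBridge_blockingWide` — the landed `stub_blocking_of_planar` (`…CoveringLegStubBlocking.lean`) with the roles of the
two slacks exchanged and the translation moved from the quad to the rectangle.

THE STATEMENT.  `R = (Ω; arcs 0–3)` is a conformal rectangle and `m > 0` a lateral margin.  There is a plate margin
`t > 0` such that for every upper comparison quad `N` with room `r` in sandwich position (points of the `r`-fattening of
`N` off `Ω` are `t`-close to `arc 1 ∪ arc 3`, all of it is `m`-far from `arc 0 ∪ arc 2`, the fattened end arcs `N.arc 0`,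
`N.arc 2` lie off `Ω`, `t`-close to `arc 1`, resp. `arc 3`), for all small meshes `δ` and translations `‖a‖ ≤ δ`: a
configuration whose COMPLEMENT has a WIDE-slack crude crossing of `N` (a closed `G_s`-path in `N` from `2√2δ`-near
`N.arc 0` to `2√2δ`-near `N.arc 2`) has no open crude crossing of the translated rectangle `R + a` (an open `G_s`-path
in `Ω + a` from `2δ`-near `arc 0 + a` to `2δ`-near `arc 2 + a`).

THE PROOF (Bollobás–Riordan 2006, Ch. 7, Claim 19 second part, p. 192; verbatim the landed proof with the slacks
exchanged).  Draw both paths as polylines through the positions `δ·zS`; they are disjoint (open ≠ closed sites, and the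
straight-line drawing of `G_s` is planar: `block_traces_disjoint` fed with the landed `stub_gsPlanar`, p140252).  Pull
both back by a square model `Φ` of `R` (`exists_isSquareModel`).  The closed polyline lies in the `r`-fattening of `N`,
hence pulls back into the horizontal band `|im| ≤ 1 − 2ν` (`block_closed_point`), its first point — `2√2δ ≤ 3δ`-close to
`N.arc 0`, so a cap point beyond `arc 1` — to `re ≥ 1 + η_r/2` (`block_re_ge_of_cap`) and its last point to
`re ≤ −1 − η_r/2`.  Every point of the open polyline is within `δ` of a site drawn in `Ω + a`, hence within `2δ` of
`Ω`, and pulls back into the strip `|re| ≤ 1 + η_r/4` once `2δ` is below a modulus of `Φ⁻¹`; its first point is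
`2δ`-close to `arc 0 + a`, so `3δ`-close to `arc 0`, and pulls back below the band, its last point above it.  The two
pulled-back polylines cross a rectangle transversally and meet (`block_model_crossing`) — a contradiction.

References: B. Bollobás, O. Riordan, *Percolation*, CUP (2006), Ch. 7 Claim 19 p. 192 [BollobasRiordan2006];
V. Beffara, *Is critical 2D percolation universal?*, Progr. Probab. 60 (2008) §5.1 [Beffara2008Universal];
O. Schramm, S. Smirnov, Ann. Probab. 39 (2011), proof of Lemma 5.1 (square models) [SchrammSmirnov2011].
(buildfix 2026-08-20: comment-only re-land to re-enqueue the module build after its blocking imports were repaired; no declaration changed.)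
-/

noncomputable section

namespace Summit.CriticalPhenomena.CardyFormulaZ2.Theorems.CardyFlipRussoTarget

open Set Metric
open Literature.Probability.RandomPlanarGeometry Literature.Probability.Percolation
open Literature.Topology.PlaneTopology
open Literature.Barriers.CriticalPhenomena (MixedSite)
open Summit.CriticalPhenomena.CardyFormulaZ2.Cruxes.CoveringLeg.FiveArmNull

/-- A point `s`-close to a boundary arc is within `s` of a point of the arc (nearest point of the compact arc).
[folklore] -/
theorem gsBridge_exists_arc_dist_le (Q : ConformalRectangle) (i : Fin 4) {p : ℂ} {s : ℝ}
    (h : infDist p (Q.arc i) ≤ s) : ∃ z ∈ Q.arc i, dist p z ≤ s := by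
  obtain ⟨q, hq, hpq⟩ := (Q.isCompact_arc i).exists_infDist_eq_dist ⟨_, Q.pt_mem_arc_self i⟩ p
  exact ⟨q, hq, by rw [← hpq]; exact h⟩

/-- **Registered sub-goal `gsBridge_blockingWide`** (exact-duality input of the limsup half of the embedding bridge
`stub_gsCardyOfUnionJack`): for every conformal rectangle `R` and margin `m > 0` there is a plate margin `t > 0` such that
for every upper quad `N` of `R` in sandwich position with room `r`, for all small meshes `δ` and every translation
`‖a‖ ≤ δ`, a configuration whose complement has a WIDE-slack crude frame-B crossing of `N` has no open crude crossing of
the translated rectangle `R + a` (planarity of the drawing of `G_s` + the square-model rectangle-crossing lemma; see the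
module docstring). [cite: BollobasRiordan2006, Ch. 7 Claim 19 (second part) p. 192] -/
theorem gsBridge_blockingWide : ∀ (R : Literature.Probability.RandomPlanarGeometry.ConformalRectangle) (m : ℝ), 0 < m → ∃ t : ℝ, 0 < t ∧ ∀ (N : Literature.Probability.RandomPlanarGeometry.ConformalRectangle) (r : ℝ), 0 < r → (∀ z ∈ Metric.cthickening r N.carrier, z ∉ R.carrier → Metric.infDist z (R.arc 1) ≤ t ∨ Metric.infDist z (R.arc 3) ≤ t) → (∀ z ∈ Metric.cthickening r N.carrier, m ≤ Metric.infDist z (R.arc 0) ∧ m ≤ Metric.infDist z (R.arc 2)) → (∀ z ∈ Metric.cthickening r (N.arc 0), z ∉ R.carrier ∧ Metric.infDist z (R.arc 1) ≤ t) → (∀ z ∈ Metric.cthickening r (N.arc 2), z ∉ R.carrier ∧ Metric.infDist z (R.arc 3) ≤ t) → ∃ δ₀ : ℝ, 0 < δ₀ ∧ ∀ δ : ℝ, 0 < δ → δ ≤ δ₀ → ∀ a : ℂ, ‖a‖ ≤ δ → ∀ ω : Set Literature.Barriers.CriticalPhenomena.MixedSite, ωᶜ ∈ Summit.CriticalPhenomena.CardyFormulaZ2.Cruxes.CoveringLeg.FiveArmNull.wideS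 N δ → ω ∉ Summit.CriticalPhenomena.CardyFormulaZ2.Cruxes.CoveringLeg.FiveArmNull.crossS (R.map (Literature.Probability.RandomPlanarGeometry.similarity 1 one_ne_zero a)) δ := by
  intro R m hm
  -- a square model of `R` and the lateral modulus `η = 4ν` of `Φ` for the margin `m`
  obtain ⟨Φ, hΦ⟩ := exists_isSquareModel R
  obtain ⟨η, hη, hη1, hucη⟩ := block_uc Φ hm
  set ν : ℝ := η / 4 with hν
  have hν0 : 0 < ν := by positivity
  have hν4 : ν ≤ 1 / 4 := by rw [hν]; linarith
  have hucm : ∀ z ∈ Icc (-2 : ℝ) 2 ×ℂ Icc (-2 : ℝ) 2, ∀ z' ∈ Icc (-2 : ℝ) 2 ×ℂ Icc (-2 : ℝ) 2,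
      dist z z' < 4 * ν → dist (Φ z) (Φ z') < m := fun z hz z' hz' hd =>
    hucη z hz z' hz' (by rw [hν] at hd; linarith)
  -- the plate margin `t = θ/2`, `θ` a modulus of `Φ⁻¹` near `closure Ω` for `ν`
  obtain ⟨θ, hθ, -, hθuc⟩ := block_symm_uc hΦ hν0
  have htθ : θ / 2 < θ := half_lt_self hθ
  refine ⟨θ / 2, half_pos hθ, ?_⟩
  intro N r hr n3 n4 n5 n6
  -- the cap modulus `η_r` of `Φ` for `r/2`, and a modulus `θ_r` of `Φ⁻¹` for `η_r/4`
  obtain ⟨ηr, hηr, hηr1, hucr⟩ := block_uc Φ (half_pos hr)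
  obtain ⟨θr, hθr, -, hθruc⟩ := block_symm_uc hΦ (by positivity : (0 : ℝ) < ηr / 4)
  refine ⟨min (r / 6) (min (θ / 6) (θr / 3)), by positivity, ?_⟩
  intro δ hδ hδle a ha ω hcl hop
  have hδr : δ ≤ r / 6 := hδle.trans (min_le_left _ _)
  have hδθ : δ ≤ θ / 6 := hδle.trans ((min_le_right _ _).trans (min_le_left _ _))
  have hδθr : δ ≤ θr / 3 := hδle.trans ((min_le_right _ _).trans (min_le_right _ _))
  -- the two crossings as chains: `f` closed in `N` (wide slack), `g` open in `Ω + a` (standard slack)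
  obtain ⟨n, f, hf0, hfn, hfN, hfadj⟩ := block_chain_of_wideS hcl
  obtain ⟨n', g, hg0, hgn, hgR, hgadj⟩ := block_chain_of_crossS hop
  set C : ℝ → ℂ := affineInterp (List.ofFn fun i => (δ : ℂ) * zS (f i)) with hC
  set O : ℝ → ℂ := affineInterp (List.ofFn fun i => (δ : ℂ) * zS (g i)) with hO
  have hC0 : C 0 = (δ : ℂ) * zS (f 0) := block_polyline_zero _
  have hCn : C n = (δ : ℂ) * zS (f (Fin.last n)) := block_polyline_last _
  have hO0 : O 0 = (δ : ℂ) * zS (g 0) := block_polyline_zero _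
  have hOn : O n' = (δ : ℂ) * zS (g (Fin.last n')) := block_polyline_last _
  have hsq : 2 * Real.sqrt 2 * δ ≤ 3 * δ := wide_slack_le_three hδ.le
  -- CLOSED SIDE.  Points of the closed polyline lie in the `r`-fattening of `N`, hence pull back into the band
  have hCpt : ∀ s ∈ Icc (0 : ℝ) n, C s ∈ cthickening r N.carrier := fun s hs => by
    obtain ⟨⟨i, hi⟩, -⟩ := block_trace_point f hfadj hδ hs.1 hs.2
    exact mem_cthickening_of_dist_le _ ((δ : ℂ) * zS (f i)) r _ (hfN i).1 (hi.trans (by linarith))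
  have hCband : ∀ s ∈ Icc (0 : ℝ) n,
      |(Φ.symm (C s)).im| ≤ 1 - 2 * ν ∧ Φ.symm (C s) ∈ Icc (-2 : ℝ) 2 ×ℂ Icc (-2 : ℝ) 2 := fun s hs =>
    block_closed_point hΦ hν0 hν4 hucm hθuc htθ (fun hx => n3 _ (hCpt s hs) hx) (n4 _ (hCpt s hs))
  have h0mem : (0 : ℝ) ∈ Icc (0 : ℝ) n := ⟨le_rfl, Nat.cast_nonneg n⟩
  have hnmem : (n : ℝ) ∈ Icc (0 : ℝ) n := ⟨Nat.cast_nonneg n, le_rfl⟩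
  -- the first point: `2√2δ ≤ 3δ`-close to `N.arc 0`, a cap point beyond `arc 1`, pulled back to `re ≥ 1 + η_r/2`
  have hstart : 1 + ηr / 2 ≤ (Φ.symm (C 0)).re := by
    obtain ⟨z0, hz0, hd0⟩ := gsBridge_exists_arc_dist_le N 0 (hf0.trans hsq)
    rw [← hC0] at hd0
    have hcap : ∀ y : ℂ, dist y (C 0) < r / 2 → y ∉ R.carrier := fun y hy =>
      (n5 y (mem_cthickening_of_dist_le y z0 r _ hz0 (by linarith [dist_triangle y (C 0) z0]))).1
    obtain ⟨-, hq1⟩ := n5 (C 0) (mem_cthickening_of_dist_le _ z0 r _ hz0 (by linarith))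
    obtain ⟨hband0, hbox0⟩ := hCband 0 h0mem
    obtain ⟨z1, hz1, hd1⟩ := block_near_side hΦ hθuc 1 hq1 htθ
    obtain ⟨hz1re, -⟩ := SquareModel.mem_arc_one.1 hz1
    obtain ⟨e1, -, -, -⟩ := block_re_im_of_dist hd1.le
    have him0 := abs_le.1 hband0
    exact block_re_ge_of_cap hΦ hηr hηr1 (half_pos hr) hucr hcap hbox0 (by linarith)
      ⟨by linarith [him0.1], by linarith [him0.2]⟩
  -- the last point: a cap point beyond `arc 3`, pulled back to `re ≤ -1 - η_r/2`
  have hend : (Φ.symm (C n)).re ≤ -1 - ηr / 2 := by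
    obtain ⟨z0, hz0, hd0⟩ := gsBridge_exists_arc_dist_le N 2 (hfn.trans hsq)
    rw [← hCn] at hd0
    have hcap : ∀ y : ℂ, dist y (C n) < r / 2 → y ∉ R.carrier := fun y hy =>
      (n6 y (mem_cthickening_of_dist_le y z0 r _ hz0 (by linarith [dist_triangle y (C n) z0]))).1
    obtain ⟨-, hq3⟩ := n6 (C n) (mem_cthickening_of_dist_le _ z0 r _ hz0 (by linarith))
    obtain ⟨hbandn, hboxn⟩ := hCband n hnmem
    obtain ⟨z3, hz3, hd3⟩ := block_near_side hΦ hθuc 3 hq3 htθ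
    obtain ⟨hz3re, -⟩ := SquareModel.mem_arc_three.1 hz3
    obtain ⟨-, e2, -, -⟩ := block_re_im_of_dist hd3.le
    have himn := abs_le.1 hbandn
    exact block_re_le_of_cap hΦ hηr hηr1 (half_pos hr) hucr hcap hboxn (by linarith)
      ⟨by linarith [himn.1], by linarith [himn.2]⟩
  -- OPEN SIDE.  Points of the open polyline are within `δ` of a site drawn in `Ω + a`, hence within `2δ` of a point of
  -- `Ω`, and pull back into the strip
  have hOstrip : ∀ s ∈ Icc (0 : ℝ) n', |(Φ.symm (O s)).re| ≤ 1 + ηr / 4 := fun s hs => by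
    obtain ⟨⟨j, hj⟩, -⟩ := block_trace_point g hgadj hδ hs.1 hs.2
    obtain ⟨z, hz, hzj⟩ := block_exists_carrier_dist_le R ha (hgR j).1
    have hd : dist (O s) z < θr :=
      calc dist (O s) z ≤ dist (O s) ((δ : ℂ) * zS (g j)) + dist ((δ : ℂ) * zS (g j)) z := dist_triangle _ _ _
        _ ≤ δ + δ := add_le_add hj hzj
        _ < θr := by linarith
    exact (block_near_carrier hΦ hθruc hz hd).le
  have hbot : (Φ.symm (O 0)).im ≤ -(1 - 2 * ν) := by
    have h0 : infDist (O 0) (R.arc 0) ≤ 3 * δ := by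
      obtain ⟨z, hz, hd⟩ := block_exists_arc_dist_le R 0 ha hg0
      rw [← hO0] at hd
      exact (infDist_le_dist_of_mem hz).trans hd
    obtain ⟨z, hz, hd⟩ := block_near_side hΦ hθuc 0 h0 (by linarith)
    obtain ⟨hzim, -⟩ := SquareModel.mem_arc_zero.1 hz
    obtain ⟨-, -, -, e4⟩ := block_re_im_of_dist hd.le
    linarith
  have htop : 1 - 2 * ν ≤ (Φ.symm (O n')).im := by
    have h2 : infDist (O n') (R.arc 2) ≤ 3 * δ := by
      obtain ⟨z, hz, hd⟩ := block_exists_arc_dist_le R 2 ha hgn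
      rw [← hOn] at hd
      exact (infDist_le_dist_of_mem hz).trans hd
    obtain ⟨z, hz, hd⟩ := block_near_side hΦ hθuc 2 h2 (by linarith)
    obtain ⟨hzim, -⟩ := SquareModel.mem_arc_two.1 hz
    obtain ⟨-, -, e3, -⟩ := block_re_im_of_dist hd.le
    linarith
  -- the pulled-back polylines cross the rectangle `[-(1 + η_r/4), 1 + η_r/4] × [-(1 - 2ν), 1 - 2ν]` transversally: they meet
  obtain ⟨s, hs, s', hs', heq⟩ := block_model_crossing (γ₁ := fun s => Φ.symm (C s)) (γ₂ := fun s => Φ.symm (O s))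
    (Φ.symm.continuous.comp (continuous_affineInterp _)) (Φ.symm.continuous.comp (continuous_affineInterp _))
    (Nat.cast_nonneg n) (Nat.cast_nonneg n') (by positivity : (0 : ℝ) ≤ 1 + ηr / 4)
    (by linarith : (0 : ℝ) < 1 - 2 * ν) (fun s hs => (hCband s hs).1) (by linarith [hstart])
    (by linarith [hend]) hOstrip hbot htop
  -- but a closed and an open polyline never meet (planarity of the drawing of `G_s`, landed `stub_gsPlanar`)
  exact block_traces_disjoint stub_gsPlanar f g hfadj hgadj (fun i j hij => (hfN i).2 (hij ▸ (hgR j).2)) hδ hs.1 hs.2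
    hs'.1 hs'.2 (Φ.symm.injective heq)

end Summit.CriticalPhenomena.CardyFormulaZ2.Theorems.CardyFlipRussoTarget

end
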